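import Summits.CriticalPhenomena.PercolationContinuityZ3.Theorems.PercNearOneGluingNoHeavyQuantSiblingStepResidual
import Summits.CriticalPhenomena.PercolationContinuityZ3.Theorems.PercNearOneGluingNoHeavyQuantGroupRegating
import Summits.CriticalPhenomena.PercolationContinuityZ3.Theorems.PercNearOneGluingNoHeavyQuantJointBlobHull
import HarnessLib

/-!
# QUANT lane R8, T-DEC: THE SIBLING STEP NET OF EVERYTHING IN THE TREE — atomic, root-pattern, GROUP-SPLIT (any hub group, via
# permutation invariance), ≤ 2-relay siblings (two-relay de-correlation), and blob-hull members (JR₃'s mechanism):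
# `SiblingStepResidual₂ ⟺ SiblingStep`

builds on p205010 (kernel theorem, internal audit signed; external expert review pending)

Statement + support file (`--supports stmt-CriticalPhenomena-4575`), QUANT lane typer seat prim-quant-stmt (gen 39 draft, gen 40 final), rung R8
of `run/shared/lean/prim/quant/LADDER.md`; README V422 ruling ("add `gateStepN_of_topTwo` to the SiblingStepResidual net") and V423.  One `Prop`
definition (`GroupCovered`), one `@[conjecture]` (`SiblingStepResidual₂`); theorems with standard axioms, no sorries.  Joins
`…QuantSiblingStepResidual` (`AtomicCovered`, `RootPatternCovered`, `siblingStep_iff_residual`) with `…QuantGroupRegating`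
(`decAt_gate_flaw_group`, typer g39), `…QuantForestPerm` (`flaw_perm`) and `…QuantJointBlobHull` (`sdec_siblings_of_lowTop` — lead g45's
`gateStepN_of_topTwo` on the list binder; `InBlobHull`, `sdec_of_inBlobHull`).

* `Stot_perm`, `xmin_perm`; `GroupCovered x a L` — some split of the siblings into a dominant hub group `J` and the rest `K` (`L ~ J ++ K`, both
  nonempty, `pdead J ≤ pdead K`) with `a·fmean L ≤ Smin J`, root relays and the floor check `x·Stot L ≤ fmean L·xmin L`;
* `decAt_siblings_of_groupCovered` (oracle ⟹ every group-covered outer gate is discharged, through `flaw_perm`);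
* `inBlobHull_flaw_of_forall` — per-sibling blob-hull membership gives the forest's (`InBlobHull.lconv`);
* **`@[conjecture] SiblingStepResidual₂`** — the list form of the node owing the DEC conclusion only for sibling lists in which EVERY sibling
  carries `≥ 3` relays, whose forest law is NOT in the blob hull at the floor, and only at the outer gates covered by NONE of the three re-gating
  families; **`siblingStep_iff_residual₂ : SiblingStep ↔ SiblingStepResidual₂`**; `farTreeRow_of_siblingStepResidual₂`.

HONEST STATUS: the residual is OPEN (README V422/V423: near-tied glued-root triples / heavy-leaf brooms, all siblings ≥ 3 relays; JR₃ conjectures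
it is empty); `SiblingStep`, `GateStepN`, `FarTreeRow` OPEN; RATE class log\* / honest sentence unchanged.  [this work].  Nothing here is cited as a
published result.  The gluing rows served [cite: KozmaNitzan2024, Conjecture 3 (p. 15)]; product measure [cite: Grimmett1999, §1.3 p. 10].
-/

noncomputable section

namespace Summit.CriticalPhenomena.PercolationContinuityZ3.Theorems
namespace Quant
namespace LawDec

/-- `Stot` is permutation invariant. [this work] -/
theorem Stot_perm {L L' : List Sib} (h : L.Perm L') : Stot L = Stot L' := by
  induction h with
  | nil => rfl
  | cons s _ ih => simp only [Stot, ih]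
  | swap s t L => simp only [Stot]; ring
  | trans _ _ ih₁ ih₂ => exact ih₁.trans ih₂

/-- `xmin` is permutation invariant. [this work] -/
theorem xmin_perm {L L' : List Sib} (h : L.Perm L') : xmin L = xmin L' := by
  induction h with
  | nil => rfl
  | cons s _ ih => simp only [xmin, ih]
  | swap s t L => simp only [xmin]; rw [← min_assoc, min_comm t.x₁ s.x₁, min_assoc]
  | trans _ _ ih₁ ih₂ => exact ih₁.trans ih₂

/-- **the group-split family covers the outer gate `a`** for the sibling list `L` at floor `x`: a split `L ~ J ++ K` into a dominant hub group
`J` and the rest `K` (both nonempty, `pdead J ≤ pdead K`), root relays, the regime `a·fmean L ≤ Smin J`, the floor check. [this work] -/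
def GroupCovered (x a : ℝ) (L : List Sib) : Prop :=
  (∀ s ∈ L, s.ρ 0 = 0) ∧ x * Stot L ≤ fmean L * xmin L ∧
    ∃ J K : List Sib, J ≠ [] ∧ K ≠ [] ∧ L.Perm (J ++ K) ∧ pdead J ≤ pdead K ∧ a * fmean L ≤ Smin J

/-- **every group-covered outer gate is discharged** (through `flaw_perm` and `decAt_gate_flaw_group`, with the node's oracle). [this work] -/
theorem decAt_siblings_of_groupCovered {x a : ℝ} (hx0 : 0 < x) (hx1 : x < 1) (L : List Sib) (hL : ∀ s ∈ L, s.TreeOK x)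
    (hO : ∀ (x' : ℝ) (n' M' : ℕ) (μ' : ℕ → ℝ), n' < fgates L → TreeBuiltN x' n' M' μ' → SDEC x' M' μ')
    (ha0 : 0 < a) (ha1 : a ≤ 1) (hcov : GroupCovered x a L) :
    ∀ j, j < ftop L → DECAt (a * x) j (ftop L) (gate (flaw L) a) := by
  obtain ⟨h0, hfl, J, K, hJne, hKne, hperm, hdom, hreg⟩ := hcov
  have hmem : ∀ s, s ∈ J ++ K ↔ s ∈ L := fun s => hperm.mem_iff.symm
  have hL' : ∀ s ∈ J ++ K, s.TreeOK x := fun s hs => hL s ((hmem s).1 hs)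
  have h0' : ∀ s ∈ J ++ K, s.ρ 0 = 0 := fun s hs => h0 s ((hmem s).1 hs)
  rw [flaw_perm hperm, ftop_perm hperm]
  rw [fmean_perm hperm, Stot_perm hperm, xmin_perm hperm] at hfl
  rw [fmean_perm hperm] at hreg
  rw [fgates_perm hperm] at hO
  exact decAt_gate_flaw_group hx0 hx1 J K hJne hKne hL' h0' hO ha0 ha1 hdom hreg hfl

/-- **PER-SIBLING HULL MEMBERSHIP SUFFICES** (`InBlobHull.lconv`): if every sibling's gated law `gate s.ρ s.q` lies in the blob hull at the
floor (mean `s.q·s.mean`, top `s.M`), so does the forest law — so JR₃'s genuinely joint content sits in groups of individually irreducible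
siblings (README V422's per-sibling 'reducibility' census is the k-fold instance). [this work] -/
theorem inBlobHull_flaw_of_forall {x : ℝ} :
    ∀ L : List Sib, (∀ s ∈ L, InBlobHull x (s.q * s.mean) s.M (gate s.ρ s.q)) → InBlobHull x (fmean L) (ftop L) (flaw L)
  | [], _ => by
    have h := inBlobHull_blobLaw x [] (fun p hp => by simp at hp) (le_refl (blobTop []))
    simpa [blobMean, blobTop, blobLaw, fmean, ftop, flaw] using h
  | s :: L, h => by
    have ih := inBlobHull_flaw_of_forall L fun t ht => h t (List.mem_cons_of_mem s ht)
    simp only [fmean, ftop, flaw]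
    exact ih.lconv (h s List.mem_cons_self)

/-- **CONJECTURE (THE SIBLING STEP NET OF EVERYTHING IN THE TREE; typer g39/g40).**  The list form of `SiblingStep` with the DEC conclusion
owed only (i) for sibling lists in which EVERY sibling's sub-forest has top `≥ 3` (siblings with `≤ 2` relays are free: lead g45's two-relay
de-correlation, `sdec_siblings_of_lowTop`), (ii) whose forest law is NOT in the blob hull at the floor (`InBlobHull x (fmean L) (ftop L) (flaw L)`
members are SDEC outright, `sdec_of_inBlobHull`; JR₃ = `JointBlobHull₃` says this never happens), and (iii) at outer gates `a ∈ (0,1]` covered by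
none of: the atomic re-gating family (`AtomicCovered`), the root-pattern family (`RootPatternCovered`), the group-split family (`GroupCovered`).
Equivalent to `SiblingStep` (`siblingStep_iff_residual₂`).
builds on p205010 (kernel theorem, internal audit signed; external expert review pending). [this work] [status: open] -/
@[conjecture] def SiblingStepResidual₂ : Prop :=
  ∀ (x : ℝ) (L : List Sib), 0 < x → x < 1 → (∀ s ∈ L, s.TreeOK x) → 3 ≤ L.length → (∀ s ∈ L, 3 ≤ s.M) →
    ¬ InBlobHull x (fmean L) (ftop L) (flaw L) →
    (∀ (x' : ℝ) (n' M' : ℕ) (μ' : ℕ → ℝ), n' < fgates L → TreeBuiltN x' n' M' μ' → SDEC x' M' μ') →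
    ∀ a : ℝ, 0 < a → a ≤ 1 → ¬ AtomicCovered x a L → ¬ RootPatternCovered x a L → ¬ GroupCovered x a L →
    ∀ j, j < ftop L → DECAt (a * x) j (ftop L) (gate (flaw L) a)

/-- **`SiblingStep ↔ SiblingStepResidual₂`.** [this work] -/
theorem siblingStep_iff_residual₂ : SiblingStep ↔ SiblingStepResidual₂ := by
  rw [siblingStep_iff_residual]
  constructor
  · intro h x L hx0 hx1 hL hk _ _ hO a ha0 ha1 hA hR _ j hj
    exact h x L hx0 hx1 hL hk hO a ha0 ha1 hA hR j hj
  · intro h x L hx0 hx1 hL hk hO a ha0 ha1 hA hR j hj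
    classical
    by_cases hlow : ∃ s ∈ L, s.M ≤ 2
    · exact sdec_siblings_of_lowTop hx0 L hL hO hlow a ha0 ha1 j hj
    by_cases hH : InBlobHull x (fmean L) (ftop L) (flaw L)
    · exact sdec_of_inBlobHull hx0 hx1 hH a ha0 ha1 j hj
    by_cases hG : GroupCovered x a L
    · exact decAt_siblings_of_groupCovered hx0 hx1 L hL hO ha0 ha1 hG j hj
    · exact h x L hx0 hx1 hL hk (fun s hs => by by_contra h3; exact hlow ⟨s, hs, by omega⟩) hH hO a ha0 ha1 hA hR hG j hj

end LawDec

/-- **`SiblingStepResidual₂ ⟹ Quant.FarTreeRow`, unconditionally.** [this work] -/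
theorem farTreeRow_of_siblingStepResidual₂ (h : LawDec.SiblingStepResidual₂) : FarTreeRow :=
  farTreeRow_of_siblingStep' (LawDec.siblingStep_iff_residual₂.2 h)

end Quant
end Summit.CriticalPhenomena.PercolationContinuityZ3.Theorems
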